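import Mathlib.RingTheory.WittVector.Compare
import Mathlib.RingTheory.TensorProduct.Nontrivial
import Mathlib.RingTheory.EssentialFiniteness
import Mathlib.FieldTheory.IntermediateField.Adjoin.Algebra
import Literature.AnabelianGeometry.AbsoluteAnabelian.AbsTopIII.KummerFaithful
import HarnessLib

/-!
# Sub-`p`-adic fields are generalized sub-`p`-adic ([Tpcs] Remark after Def 4.11)

Proof-only companion to `AbsTopIII/KummerFaithful.lean` (the cell's REAL definitions
`AbsTopIII.IsSubpadicFor` = [pGC] Def 15.4 (i) p. 77 and `AbsTopIII.IsGeneralizedSubpadicFor` =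
[Tpcs] Def 4.11 p. 44): "Note that sub-`p`-adic fields are always generalized sub-`p`-adic" ([Tpcs],
S. Mochizuki, *Topics surrounding the anabelian geometry of hyperbolic curves* (2003), Remark
following Definition 4.11, manuscript p. 44, lit key `paper:url-b6dd3c96bfbd`).  PROVED here
(`IsSubpadicFor.isGeneralizedSubpadicFor`): `ℚ_p = Frac W(𝔽_p) ↪ Frac W(𝔽̄_p)` (Mathlib's
`WittVector.equiv : 𝕎(ℤ/p) ≃ ℤ_p` and functoriality of `𝕎`), and a finitely generated extension
`L/ℚ_p` base-changes to the finitely generated extension `(Frac W(𝔽̄_p) ⊗_{ℚ_p} L)/𝔪` of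
`Frac W(𝔽̄_p)` (`𝔪` any maximal ideal).  This discharges the named fact `Tpcs.Rmk_4_11` of
`RelativeGrothendieckConjecture.lean` (the one-line derivation is filed with that module's proof
companion).  No new definitions. [cite: MochizukiTopics2003, Def 4.11 p.44]
-/

universe u

namespace Literature.AnabelianGeometry.AbsoluteAnabelian.AbsTopIII

open scoped TensorProduct

/-- There is a ring homomorphism `ℚ_p → Frac W(𝔽̄_p)` (through `ℤ_p ≅ W(𝔽_p) ↪ W(𝔽̄_p)`); stated as
an existence so that this file declares no data. [cite: MochizukiTopics2003, Def 4.11 p.44] -/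
theorem nonempty_padic_ringHom_fracWitt (p : ℕ) [Fact p.Prime] :
    Nonempty (ℚ_[p] →+* FractionRing (WittVector p (AlgebraicClosure (ZMod p)))) := by
  let ιF : ZMod p →+* AlgebraicClosure (ZMod p) := algebraMap (ZMod p) (AlgebraicClosure (ZMod p))
  let g : ℤ_[p] →+* FractionRing (WittVector p (AlgebraicClosure (ZMod p))) :=
    (algebraMap (WittVector p (AlgebraicClosure (ZMod p))) _).comp
      ((WittVector.map ιF).comp (WittVector.equiv p).symm.toRingHom)
  have hg : Function.Injective g := by
    refine (IsFractionRing.injective (WittVector p (AlgebraicClosure (ZMod p))) _).comp ?_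
    exact (WittVector.map_injective ιF ιF.injective).comp (WittVector.equiv p).symm.injective
  exact ⟨IsFractionRing.lift hg⟩

/-- **[Tpcs] Remark following Definition 4.11** p. 44: a sub-`p`-adic field is generalized
sub-`p`-adic.  Proof: `K ↪ L` with `L/ℚ_p` finitely generated; `A := Frac W(𝔽̄_p) ⊗_{ℚ_p} L` is a
nonzero ring, essentially of finite type over `Frac W(𝔽̄_p)` (base change); for a maximal ideal `𝔪`,
`A/𝔪` is a field, finitely generated over `Frac W(𝔽̄_p)`, receiving `K → L → A → A/𝔪`.
[cite: MochizukiTopics2003, Def 4.11 p.44] -/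
theorem IsSubpadicFor.isGeneralizedSubpadicFor {K : Type u} [Field K] {p : ℕ} [Fact p.Prime]
    (h : IsSubpadicFor K p) : IsGeneralizedSubpadicFor K p := by
  classical
  obtain ⟨L, _, _, hL, ⟨ι⟩⟩ := h.exists_embedding
  obtain ⟨φ₀⟩ := nonempty_padic_ringHom_fracWitt p
  let B : Type := FractionRing (WittVector p (AlgebraicClosure (ZMod p)))
  letI : Algebra ℚ_[p] B := φ₀.toAlgebra
  haveI : Nontrivial (B ⊗[ℚ_[p]] L) :=
    Algebra.TensorProduct.nontrivial_of_algebraMap_injective_of_isDomain ℚ_[p] B L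
      (algebraMap ℚ_[p] B).injective (algebraMap ℚ_[p] L).injective
  obtain ⟨𝔪, h𝔪⟩ := Ideal.exists_maximal (B ⊗[ℚ_[p]] L)
  letI : Field ((B ⊗[ℚ_[p]] L) ⧸ 𝔪) := Ideal.Quotient.field 𝔪
  haveI : Algebra.EssFiniteType ℚ_[p] L := IntermediateField.fg_top_iff.mp hL
  haveI : Algebra.EssFiniteType B ((B ⊗[ℚ_[p]] L) ⧸ 𝔪) :=
    Algebra.EssFiniteType.of_surjective (Ideal.Quotient.mkₐ B 𝔪)
      (Ideal.Quotient.mkₐ_surjective B 𝔪)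
  exact ⟨⟨(B ⊗[ℚ_[p]] L) ⧸ 𝔪, inferInstance, inferInstance,
    IntermediateField.fg_top_iff.mpr inferInstance,
    ⟨(Ideal.Quotient.mk 𝔪).comp
      ((Algebra.TensorProduct.includeRight (R := ℚ_[p]) (A := B) (B := L)).toRingHom.comp ι)⟩⟩⟩

/-- Prime-free form: a sub-`p`-adic field is generalized sub-`p`-adic for the same prime.
[cite: MochizukiTopics2003, Def 4.11 p.44] -/
theorem IsSubpadic.exists_isGeneralizedSubpadicFor {K : Type u} [Field K] (h : IsSubpadic K) :
    ∃ (p : ℕ) (_ : Fact p.Prime), IsGeneralizedSubpadicFor K p := by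
  obtain ⟨p, hp, hK⟩ := h.exists_prime
  exact ⟨p, hp, hK.isGeneralizedSubpadicFor⟩

end Literature.AnabelianGeometry.AbsoluteAnabelian.AbsTopIII
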